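import Mathlib
import Summits.PneNP.PneNP.Theorems.OverlapGapAlgebraSolvableImpliesStableSectionMonotoneRepairTreeAsm

/-!
# PneNP / OverlapGapAlgebra — crux `SolvableImpliesStableSection` (stmt-PneNP-2463):
# the MONOTONE REPAIR block (4/·) — tree codes: the depth-indexed family is well formed

Support for crux `stmt-PneNP-2463` (`Summit.PneNP.PneNP.Theses.OverlapGapAlgebra.SolvableImpliesStableSection`):
the f-free block "bounded-round monotone repair gives stable sections up to `α ≤ 2^k/(4k)`".
The tree codes of depth `≤ d` form an opaque family `TS d` specified by two hypotheses: `TS 0` consists of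
the bare roots `asm c r (fun _ => none)` (`r ≤ L`), and `TS (d+1)` of the codes `asm c r ch` assembled
from a root label `(c, r)`, `r ≤ L`, and optional subtrees `ch j ∈ TS d` (`hTS0`, `hTSs`; `asm` as in
`…MonotoneRepairTreeAsm`).  Consequences:

* `sissR_asm_valid_step`, `sissR_TS_valid` — every `T ∈ TS d` is WELL FORMED: it has a root
  `([], (c, r))` with `r ≤ L`, carries at most one label per address, is closed under passing to the
  parent address, and all its addresses have length `≤ d` and rounds `≤ L`;
* `sissR_TS_rootCount` — hence exactly one element sits at the root address;
* `sissR_TS_mono`, `sissR_TS_mono_le` — the family increases with `d`.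
No definitions (all objects are hypotheses); axioms `propext`, `Classical.choice`, `Quot.sound`.
-/

set_option linter.dupNamespace false -- `Summit.PneNP.PneNP.…`: summit = sub-problem (D-0017)

namespace Summit.PneNP.PneNP.Theorems

open Finset
open scoped Classical

section TreeFamily

variable {m k n : ℕ}

/-- A nonempty address splits off its LAST slot: `j' :: a = b ++ [j]` with either `b = []`
(then `a = []`, `j = j'`) or `b = j' :: b'` and `a = b' ++ [j]`. -/
theorem sissR_cons_eq_concat_cases (j' : Fin k) (a b : List (Fin k)) (j : Fin k)
    (h : j' :: a = b ++ [j]) :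
    (b = [] ∧ a = [] ∧ j' = j) ∨ ∃ b' : List (Fin k), b = j' :: b' ∧ a = b' ++ [j] := by
  cases b with
  | nil =>
    left
    simp only [List.nil_append, List.cons.injEq] at h
    exact ⟨rfl, h.2, h.1⟩
  | cons x b' =>
    right
    simp only [List.cons_append, List.cons.injEq] at h
    exact ⟨b', by rw [h.1], h.2⟩

/-- **Assembling preserves well-formedness.** If every subtree `ch j = some S` is well formed at depth
`d` (root with round `≤ L`, functional, parent-closed, addresses of length `≤ d`, rounds `≤ L`), then
`asm c r ch` (`r ≤ L`) is well formed at depth `d + 1`. -/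
theorem sissR_asm_valid_step (asm : Fin m → ℕ → (Fin k → Option (Finset (List (Fin k) × (Fin m × ℕ)))) → Finset (List (Fin k) × (Fin m × ℕ)))
    (hasm : ∀ (c : Fin m) (r : ℕ) (ch : Fin k → Option (Finset (List (Fin k) × (Fin m × ℕ))))
      (e : (List (Fin k) × (Fin m × ℕ))), e ∈ asm c r ch ↔ (e = ([], (c, r)) ∨
      ∃ (j : Fin k) (S : Finset (List (Fin k) × (Fin m × ℕ))), ch j = some S ∧
        ∃ b : List (Fin k), (b, e.2) ∈ S ∧ e.1 = b ++ [j]))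
    (L d : ℕ) (c : Fin m) (r : ℕ) (hr : r ≤ L) (ch : Fin k → Option (Finset (List (Fin k) × (Fin m × ℕ))))
    (hch : ∀ (j : Fin k) (S : Finset (List (Fin k) × (Fin m × ℕ))), ch j = some S →
      (∃ (c' : Fin m) (r' : ℕ), r' ≤ L ∧ (([] : List (Fin k)), (c', r')) ∈ S) ∧
      (∀ (a : List (Fin k)) (lab lab' : Fin m × ℕ), (a, lab) ∈ S → (a, lab') ∈ S → lab = lab') ∧
      (∀ (j' : Fin k) (a : List (Fin k)) (lab : Fin m × ℕ), (j' :: a, lab) ∈ S →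
        ∃ lab' : Fin m × ℕ, (a, lab') ∈ S) ∧
      (∀ e ∈ S, e.1.length ≤ d ∧ e.2.2 ≤ L)) :
    (∃ (c' : Fin m) (r' : ℕ), r' ≤ L ∧ (([] : List (Fin k)), (c', r')) ∈ asm c r ch) ∧
    (∀ (a : List (Fin k)) (lab lab' : Fin m × ℕ), (a, lab) ∈ asm c r ch → (a, lab') ∈ asm c r ch →
      lab = lab') ∧
    (∀ (j' : Fin k) (a : List (Fin k)) (lab : Fin m × ℕ), (j' :: a, lab) ∈ asm c r ch →
      ∃ lab' : Fin m × ℕ, (a, lab') ∈ asm c r ch) ∧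
    (∀ e ∈ asm c r ch, e.1.length ≤ d + 1 ∧ e.2.2 ≤ L) := by
  refine ⟨⟨c, r, hr, (sissR_asm_mem_nil asm hasm c r ch (c, r)).2 rfl⟩, ?_, ?_, ?_⟩
  · -- functional
    intro a lab lab' h h'
    rcases List.eq_nil_or_concat a with rfl | ⟨b, j, rfl⟩
    · rw [sissR_asm_mem_nil asm hasm] at h h'
      rw [h, h']
    · rw [List.concat_eq_append, sissR_asm_mem_concat asm hasm] at h h'
      obtain ⟨S, hS, hb⟩ := h
      obtain ⟨S', hS', hb'⟩ := h'
      rw [hS] at hS'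
      cases hS'
      exact (hch j S hS).2.1 b lab lab' hb hb'
  · -- closed under passing to the parent address
    intro j' a lab h
    rcases List.eq_nil_or_concat (j' :: a) with h0 | ⟨b, j, hbj⟩
    · exact absurd h0 (List.cons_ne_nil j' a)
    · rw [List.concat_eq_append] at hbj
      rw [hbj, sissR_asm_mem_concat asm hasm] at h
      obtain ⟨S, hS, hb⟩ := h
      rcases sissR_cons_eq_concat_cases j' a b j hbj with ⟨rfl, rfl, rfl⟩ | ⟨b', rfl, rfl⟩
      · exact ⟨(c, r), (sissR_asm_mem_nil asm hasm c r ch (c, r)).2 rfl⟩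
      · obtain ⟨lab', hlab'⟩ := (hch j S hS).2.2.1 j' b' lab hb
        exact ⟨lab', (sissR_asm_mem_concat asm hasm c r ch b' j lab').2 ⟨S, hS, hlab'⟩⟩
  · -- lengths and rounds
    intro e he
    rw [hasm] at he
    rcases he with rfl | ⟨j, S, hS, b, hb, he1⟩
    · exact ⟨Nat.zero_le _, hr⟩
    · have hS' := (hch j S hS).2.2.2 (b, e.2) hb
      refine ⟨?_, hS'.2⟩
      rw [he1, List.length_append, List.length_singleton]
      exact Nat.succ_le_succ hS'.1

/-- **Every tree code is well formed.** For every `d` and `T ∈ TS d`: a root `([], (c, r))` with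
`r ≤ L`; at most one label per address; closed under passing to the parent address; addresses of
length `≤ d`; rounds `≤ L`. -/
theorem sissR_TS_valid (asm : Fin m → ℕ → (Fin k → Option (Finset (List (Fin k) × (Fin m × ℕ)))) → Finset (List (Fin k) × (Fin m × ℕ)))
    (hasm : ∀ (c : Fin m) (r : ℕ) (ch : Fin k → Option (Finset (List (Fin k) × (Fin m × ℕ))))
      (e : (List (Fin k) × (Fin m × ℕ))), e ∈ asm c r ch ↔ (e = ([], (c, r)) ∨
      ∃ (j : Fin k) (S : Finset (List (Fin k) × (Fin m × ℕ))), ch j = some S ∧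
        ∃ b : List (Fin k), (b, e.2) ∈ S ∧ e.1 = b ++ [j]))
    (TS : ℕ → Finset (Finset (List (Fin k) × (Fin m × ℕ)))) (L : ℕ)
    (hTS0 : ∀ T : Finset (List (Fin k) × (Fin m × ℕ)), T ∈ TS 0 ↔
      ∃ (c : Fin m) (r : ℕ), r ≤ L ∧ T = asm c r (fun _ => none))
    (hTSs : ∀ (d : ℕ) (T : Finset (List (Fin k) × (Fin m × ℕ))), T ∈ TS (d + 1) ↔
      ∃ (c : Fin m) (r : ℕ), r ≤ L ∧ ∃ ch : Fin k → Option (Finset (List (Fin k) × (Fin m × ℕ))),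
        (∀ (j : Fin k) (S : Finset (List (Fin k) × (Fin m × ℕ))), ch j = some S → S ∈ TS d) ∧ T = asm c r ch) :
    ∀ (d : ℕ) (T : Finset (List (Fin k) × (Fin m × ℕ))), T ∈ TS d →
      (∃ (c : Fin m) (r : ℕ), r ≤ L ∧ (([] : List (Fin k)), (c, r)) ∈ T) ∧
      (∀ (a : List (Fin k)) (lab lab' : Fin m × ℕ), (a, lab) ∈ T → (a, lab') ∈ T → lab = lab') ∧
      (∀ (j' : Fin k) (a : List (Fin k)) (lab : Fin m × ℕ), (j' :: a, lab) ∈ T →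
        ∃ lab' : Fin m × ℕ, (a, lab') ∈ T) ∧
      (∀ e ∈ T, e.1.length ≤ d ∧ e.2.2 ≤ L) := by
  intro d
  induction d with
  | zero =>
    intro T hT
    obtain ⟨c, r, hr, rfl⟩ := (hTS0 T).1 hT
    -- a bare root: its only element is the root
    have hel : ∀ e ∈ asm c r (fun _ => none), e = ([], (c, r)) := by
      intro e he
      rw [hasm] at he
      rcases he with h | ⟨j, S, hS, _⟩
      · exact h
      · exact absurd hS (by simp)
    refine ⟨⟨c, r, hr, (sissR_asm_mem_nil asm hasm c r _ (c, r)).2 rfl⟩, ?_, ?_, ?_⟩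
    · intro a lab lab' h h'
      have h1 := hel _ h
      have h2 := hel _ h'
      rw [(Prod.mk.inj h1).2, (Prod.mk.inj h2).2]
    · intro j' a lab h
      exact absurd (Prod.mk.inj (hel _ h)).1 (List.cons_ne_nil j' a)
    · intro e he
      rw [hel e he]
      exact ⟨le_rfl, hr⟩
  | succ d ih =>
    intro T hT
    obtain ⟨c, r, hr, ch, hch, rfl⟩ := (hTSs d T).1 hT
    exact sissR_asm_valid_step asm hasm L d c r hr ch (fun j S hS => ih S (hch j S hS))

/-- **Exactly one element sits at the root address** of a tree code. -/
theorem sissR_TS_rootCount (asm : Fin m → ℕ → (Fin k → Option (Finset (List (Fin k) × (Fin m × ℕ)))) → Finset (List (Fin k) × (Fin m × ℕ)))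
    (hasm : ∀ (c : Fin m) (r : ℕ) (ch : Fin k → Option (Finset (List (Fin k) × (Fin m × ℕ))))
      (e : (List (Fin k) × (Fin m × ℕ))), e ∈ asm c r ch ↔ (e = ([], (c, r)) ∨
      ∃ (j : Fin k) (S : Finset (List (Fin k) × (Fin m × ℕ))), ch j = some S ∧
        ∃ b : List (Fin k), (b, e.2) ∈ S ∧ e.1 = b ++ [j]))
    (TS : ℕ → Finset (Finset (List (Fin k) × (Fin m × ℕ)))) (L : ℕ)
    (hTS0 : ∀ T : Finset (List (Fin k) × (Fin m × ℕ)), T ∈ TS 0 ↔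
      ∃ (c : Fin m) (r : ℕ), r ≤ L ∧ T = asm c r (fun _ => none))
    (hTSs : ∀ (d : ℕ) (T : Finset (List (Fin k) × (Fin m × ℕ))), T ∈ TS (d + 1) ↔
      ∃ (c : Fin m) (r : ℕ), r ≤ L ∧ ∃ ch : Fin k → Option (Finset (List (Fin k) × (Fin m × ℕ))),
        (∀ (j : Fin k) (S : Finset (List (Fin k) × (Fin m × ℕ))), ch j = some S → S ∈ TS d) ∧ T = asm c r ch)
    (d : ℕ) (T : Finset (List (Fin k) × (Fin m × ℕ))) (hT : T ∈ TS d) :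
    (T.filter fun e => e.1 = []).card = 1 := by
  obtain ⟨⟨c, r, _, hroot⟩, hfun, _, _⟩ := sissR_TS_valid asm hasm TS L hTS0 hTSs d T hT
  rw [Finset.card_eq_one]
  refine ⟨([], (c, r)), ?_⟩
  ext e
  rw [Finset.mem_filter, Finset.mem_singleton]
  constructor
  · rintro ⟨he, he1⟩
    have hlab := hfun [] e.2 (c, r) (by rw [← he1]; exact he) hroot
    ext1
    · exact he1
    · exact hlab
  · rintro rfl
    exact ⟨hroot, rfl⟩

/-- **The family increases with the depth**: `TS d ⊆ TS (d + 1)`. -/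
theorem sissR_TS_mono (asm : Fin m → ℕ → (Fin k → Option (Finset (List (Fin k) × (Fin m × ℕ)))) → Finset (List (Fin k) × (Fin m × ℕ)))
    (TS : ℕ → Finset (Finset (List (Fin k) × (Fin m × ℕ)))) (L : ℕ)
    (hTS0 : ∀ T : Finset (List (Fin k) × (Fin m × ℕ)), T ∈ TS 0 ↔
      ∃ (c : Fin m) (r : ℕ), r ≤ L ∧ T = asm c r (fun _ => none))
    (hTSs : ∀ (d : ℕ) (T : Finset (List (Fin k) × (Fin m × ℕ))), T ∈ TS (d + 1) ↔
      ∃ (c : Fin m) (r : ℕ), r ≤ L ∧ ∃ ch : Fin k → Option (Finset (List (Fin k) × (Fin m × ℕ))),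
        (∀ (j : Fin k) (S : Finset (List (Fin k) × (Fin m × ℕ))), ch j = some S → S ∈ TS d) ∧ T = asm c r ch) :
    ∀ (d : ℕ) (T : Finset (List (Fin k) × (Fin m × ℕ))), T ∈ TS d → T ∈ TS (d + 1) := by
  intro d
  induction d with
  | zero =>
    intro T hT
    obtain ⟨c, r, hr, rfl⟩ := (hTS0 T).1 hT
    exact (hTSs 0 _).2 ⟨c, r, hr, fun _ => none, fun j S hS => absurd hS (by simp), rfl⟩
  | succ d ih =>
    intro T hT
    obtain ⟨c, r, hr, ch, hch, rfl⟩ := (hTSs d T).1 hT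
    exact (hTSs (d + 1) _).2 ⟨c, r, hr, ch, fun j S hS => ih S (hch j S hS), rfl⟩

/-- `TS s ⊆ TS d` for `s ≤ d`. -/
theorem sissR_TS_mono_le (asm : Fin m → ℕ → (Fin k → Option (Finset (List (Fin k) × (Fin m × ℕ)))) → Finset (List (Fin k) × (Fin m × ℕ)))
    (TS : ℕ → Finset (Finset (List (Fin k) × (Fin m × ℕ)))) (L : ℕ)
    (hTS0 : ∀ T : Finset (List (Fin k) × (Fin m × ℕ)), T ∈ TS 0 ↔
      ∃ (c : Fin m) (r : ℕ), r ≤ L ∧ T = asm c r (fun _ => none))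
    (hTSs : ∀ (d : ℕ) (T : Finset (List (Fin k) × (Fin m × ℕ))), T ∈ TS (d + 1) ↔
      ∃ (c : Fin m) (r : ℕ), r ≤ L ∧ ∃ ch : Fin k → Option (Finset (List (Fin k) × (Fin m × ℕ))),
        (∀ (j : Fin k) (S : Finset (List (Fin k) × (Fin m × ℕ))), ch j = some S → S ∈ TS d) ∧ T = asm c r ch)
    (s d : ℕ) (hsd : s ≤ d) (T : Finset (List (Fin k) × (Fin m × ℕ))) (hT : T ∈ TS s) : T ∈ TS d := by
  obtain ⟨e, rfl⟩ := Nat.exists_eq_add_of_le hsd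
  induction e with
  | zero => exact hT
  | succ e ih =>
    exact sissR_TS_mono asm TS L hTS0 hTSs (s + e) T (ih (Nat.le_add_right s e))

end TreeFamily

end Summit.PneNP.PneNP.Theorems
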